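import Literature.MathematicalPhysics.QuantumFieldTheory.Balaban1983to89.B9LocalCubeGeometryOneLevelY

/-!
# `Balaban1983to89.B9LocalCubeGeometryTwoLevelWindowY` — [4] (2.2) p. 224 «(Lʲη)⁻¹ dist(Ω_jᶜ, Ω_{j+1}) > RM» read AT the enlarged cube `□̃(c)` of [B9] p. 408:
# THE TWO-LEVEL WINDOW OF `cubeDomY x c` AND OF ITS TWO-BLOCK COLLAR, FOR EVERY COVER CUBE AT EVERY MEMBER, FROM `KIdx.hR2 : 2L² ≤ R` ALONE
# (row 17's displayed cube hypotheses `h2`, `hNbr2` of `…N06Row17LocalCentreTwoLevelOfLev` DISCHARGED)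

T. Bałaban, *Propagators for lattice gauge theories in a background field*, Commun. Math. Phys. **99** (1985) 389–434 [Balaban1985BackgroundPropagators];
[4] = T. Bałaban, *Propagators and renormalization transformations for lattice gauge theories. II*, Commun. Math. Phys. **96** (1984) 223–250
[Balaban1984PropagatorsII].  Statement-level skeleton with citation tags; proofs where landed; nothing here is a claim about the Yang–Mills mass gap.

THE PRINT.  [4] p. 224, (2.2): *«(Lʲη)⁻¹ dist(Ω_jᶜ, Ω_{j+1}) > RM»*; p. 239, (2.89): *«B^j(Λ) = □̃ ∩ B^{j+1}(Λ_{j+1})»* — the enlarged cube meets the blocks of at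
most TWO consecutive levels; [B9] p. 408: *«Let us denote by □̃ a cube which is a sum of □ and the neighboring cubes from 𝒟»*.

WHY THIS FILE (cell context, 2026-08-28).  Row 17's local centre number at an interface cube (`Summits/…/BalabanUVNodesN06Row17LocalCentreTwoLevelOfLev`,
this seat g25) displays two GEOMETRIC hypotheses on `D := cubeDomY x c`: (`h2`) the fine sites of `□̃(c)` have levels in `{j, j+1}`; (`hNbr2`) no fine site of
level `≥ j+2` lies under a scale-`(j+1)` block two steps (on `T^{(j+1)}`) around a scale-`(j+1)` block meeting `□̃(c)`.  THIS FILE PROVES BOTH, for EVERY cover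
cube `c` at EVERY member `x`, with `j ∈ {j(c) − 1, j(c)}`, `j + 1 ≤ k`, from the member's `R ≥ 2L²` alone: the blocks of `□̃(c)` lie within `13S∕4` of the
cube centre modulo the period (r03 `B6Cover236QbigOverlapV1.window_and_congr_of_mem_QbigT`, `S = M_h L^{j(c)+1}`), so two sites of `□̃(c)` are at TORUS
sup-distance `≤ 15S∕2`, the cube's witness (a level-`j(c)` site of the central big block) is within `17S∕4` of every site of `□̃(c)`, and (2.2) (`TDomains.sepT`)
at level `j(c)` resp. `j(c)+1` separates levels `≤ j(c)−1 ∣ ≥ j(c)+1` resp. `≤ j(c) ∣ ≥ j(c)+2` by `R·S > 8S` resp. `R·L·S`.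
* §1 `exists_abs_sub_ctr_le_of_mem_cubeDomY`, ★ `torusSupNorm_sub_le_of_mem_cubeDomY` (diameter `15S∕2`), ★ `torusSupNorm_wit_sub_le_of_mem_cubeDomY` (`17S∕4`).
* §2 `lev_window_of_mem_cubeDomY` (`j(c) − 1 ≤ lev ≤ j(c) + 1`), ★ `lev_le_of_mem_cubeDomY_of_low` (a level-`(j(c)−1)` site in `□̃(c)` forces `lev ≤ j(c)` on `□̃(c)`),
  `torusSupNorm_lt_of_adj` ∕ `torusSupNorm_le_of_two_steps` (two `T^{(n)}`-steps cost `< 4Lⁿ ≤ S∕2`), ★ `lev_le_succ_of_near_cubeDomY`, ★ `lev_le_of_near_cubeDomY_of_low`.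
* §3 ★★★ `exists_twoLevel_window_cubeDomY` — `∃ j, j + 1 ≤ k ∧ (j = j(c) ∨ j + 1 = j(c)) ∧ h2(j) ∧ hNbr2(j)` in the binder shapes of row 17's faces.
HONEST SCOPE.  Lattice bookkeeping over landed dictionaries ((2.2) as typed in `TDomains.sepT`; r03∕p38's cube charts); no estimate of [B9]; NOT a node discharge;
count-neutral; one finite 𝕋⁴ programme — nothing about the continuum, OS or the mass gap.  Cell `pub-ymgap` (D-0062), node N06 [B9] × N10 ROAD «C», seat
`pub-ymgap-dag-n06-j` gen 26, 2026-08-28.  No `sorry`∕`axiom`∕`instance`∕`def`; nothing landed is modified.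
-/

noncomputable section

namespace Literature.MathematicalPhysics.QuantumFieldTheory.Balaban1983to89.B9LocalCubeGeometryTwoLevelWindowY

open Literature.MathematicalPhysics.QuantumFieldTheory.Balaban1983to89
open Literature.MathematicalPhysics.QuantumFieldTheory.Balaban1983to89.Node00
open Literature.MathematicalPhysics.QuantumFieldTheory.Balaban1983to89.B6KLevelCensusIndexV1 (KIdx)
open Literature.MathematicalPhysics.QuantumFieldTheory.Balaban1983to89.B6GlobalChartV1 (PV boxEquiv toBox toBox_apply domT)
open Literature.MathematicalPhysics.QuantumFieldTheory.Balaban1983to89.B4Reflection242 (boxDom mem_boxDom blk)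
open Literature.MathematicalPhysics.QuantumFieldTheory.Balaban1983to89.B4TorusKernel.MultiPeriod (torusSupNorm circAbs circAbs_le_abs circAbs_add_mul circAbs_nonneg)
open Literature.MathematicalPhysics.QuantumFieldTheory.Balaban1983to89.B6MultiLevelBoxOperator (N0 bigSide one_le_bigSide Domains)
open Literature.MathematicalPhysics.QuantumFieldTheory.Balaban1983to89.B6MultiLevelTorusOperator (TDomains)
open Literature.MathematicalPhysics.QuantumFieldTheory.Balaban1983to89.B6Geom246MultiLevelBox (bset blkOf blkOf_val lev_eq_of_blkOf_eq toR)
open Literature.MathematicalPhysics.QuantumFieldTheory.Balaban1983to89.B6Geom246MultiLevelTorus (torusSupNorm_neg)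
open Literature.MathematicalPhysics.QuantumFieldTheory.Balaban1983to89.B6Cover236MultiLevelBlocks (cubes side ctr wit lev_wit blk_wit dist_toR_ctr_le)
open Literature.MathematicalPhysics.QuantumFieldTheory.Balaban1983to89.B6Cover236MultiLevelTorusBlocks (rep blkOf_rep)
open Literature.MathematicalPhysics.QuantumFieldTheory.Balaban1983to89.B6Cover236MultiLevelTorusReach (abs_sub_le_of_blkOf_eq)
open Literature.MathematicalPhysics.QuantumFieldTheory.Balaban1983to89.B6Cover236QbigOverlapV1 (window_and_congr_of_mem_QbigT)
open Literature.MathematicalPhysics.QuantumFieldTheory.Balaban1983to89.B6Partition118KLevelTorusCentral (QbigT level_bounds pow_le_half_bigSide)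
open Literature.MathematicalPhysics.QuantumFieldTheory.Balaban1983to89.B6MemberOfCubeV1 (torusSupNorm_lt_of_block_shift torusSupNorm_sub_le one_le_N0)
open Literature.MathematicalPhysics.QuantumFieldTheory.Balaban1983to89.B6Ineq2142KLevelV1 (torusSupNorm_lt_of_block_eq)
open Literature.MathematicalPhysics.QuantumFieldTheory.Balaban1983to89.B6ScalarChartV1 (exists_iterBlockOf_eq)
open Literature.MathematicalPhysics.QuantumFieldTheory.Balaban1983to89.B5Eq118OneStroke (iterBlock iterBlockOf mem_iterBlock)
open Literature.MathematicalPhysics.QuantumFieldTheory.Balaban1983to89.B9PinMembersKLevelV1 (MemberY)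
open Literature.MathematicalPhysics.QuantumFieldTheory.Balaban1983to89.B9WalkLettersCoordsS (cubeDomY cubeBlksY four_le_P)
open Literature.MathematicalPhysics.QuantumFieldTheory.Balaban1983to89.B9DeltaALocalReadingsInCollarY (mem_cubeDomY_iff_blkOf)
open Literature.MathematicalPhysics.QuantumFieldTheory.Balaban1983to89.B9LocalCubeGeometryOneLevelY (chartY_eq_toBox)
open Literature.MathematicalPhysics.QuantumFieldTheory.Balaban1983to89.Node00.OpsYNablaBridge (chartY)
open Literature.MathematicalPhysics.QuantumFieldTheory.Balaban1983to89.B9Thm37CubeCoverCommutators (one_le_Mh_and_P)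

variable {d ℓ : ℕ} {hd : 1 ≤ d + 1} {hL : Odd (ℓ + 1) ∧ 1 < ℓ + 1} {b₀ b₁ : ℝ} {Mstar : ℕ}
variable (x : MemberY d ℓ hd hL b₀ b₁ Mstar) (c : ↥(cubes x.toKIdx.D.toDomains))

/-! ## §0 The member's numerals: `R ≥ 8`, `4L^{j(c)+1} ≤ S∕2` -/

/-- `R ≥ 8` at a member: `2L² ≤ R` (`KIdx.hR2`) with `L ≥ 5` (`KIdx.hℓ`). [cite: Balaban1984PropagatorsII, (2.36) p.229, bookkeeping] -/
theorem eight_le_R : 8 ≤ x.toKIdx.R := by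
  have h1 := x.toKIdx.hR2
  have h2 : 4 ≤ ℓ := x.toKIdx.hℓ
  have h3 : (4 + 1) ^ 2 ≤ (ℓ + 1) ^ 2 := Nat.pow_le_pow_left (by omega) 2
  omega

/-- the big-block side `S = M_h·L^{j(c)+1}` is positive. [cite: Balaban1984PropagatorsII, p.229, bookkeeping] -/
theorem bigSide_pos (j : ℕ) : (0 : ℝ) < (bigSide ℓ x.toKIdx.Mh j : ℝ) :=
  Nat.cast_pos.2 (one_le_bigSide (one_le_Mh_and_P x.toKIdx).1 _)

/-- four scale-`n` block sides fit in half a big block: `4·Lⁿ ≤ S∕2` for `n ≤ j(c) + 1` (`M_h ≥ 8`). [cite: Balaban1984PropagatorsII, (2.36) p.229 (M ≥ 8 big blocks), bookkeeping] -/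
theorem four_pow_le_half_bigSide {n j : ℕ} (hn : n ≤ j + 1) :
    4 * (((ℓ + 1 : ℕ) : ℝ)) ^ n ≤ (bigSide ℓ x.toKIdx.Mh j : ℝ) / 2 := by
  have h8 : (8 : ℝ) ≤ x.toKIdx.Mh := by exact_mod_cast x.toKIdx.hM8
  have hL1 : (1 : ℝ) ≤ (((ℓ + 1 : ℕ) : ℝ)) := by exact_mod_cast Nat.succ_le_succ (Nat.zero_le ℓ)
  have hpow : (((ℓ + 1 : ℕ) : ℝ)) ^ n ≤ (((ℓ + 1 : ℕ) : ℝ)) ^ (j + 1) := pow_le_pow_right₀ hL1 hn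
  have hpos : (0 : ℝ) ≤ (((ℓ + 1 : ℕ) : ℝ)) ^ (j + 1) := by positivity
  have e : (bigSide ℓ x.toKIdx.Mh j : ℝ) = (x.toKIdx.Mh : ℝ) * (((ℓ + 1 : ℕ) : ℝ)) ^ (j + 1) := by
    unfold bigSide; push_cast; ring
  rw [e]
  nlinarith

/-! ## §1 Torus distances inside `□̃(c)`: every site is within `15S∕4` of the cube centre modulo the period -/

/-- a site `z` of `□̃(c) = cubeDomY x c`: in every coordinate, `|z_μ − (β_μ + ½)S − N₀_μ·m| ≤ 15S∕4 − 1` for some integer `m` (its block lies within `13S∕4` of the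
centre modulo the period, r03's `window_and_congr_of_mem_QbigT`, and the block has side `L^{j(a)} ≤ S∕2`).
[cite: Balaban1984PropagatorsII, (2.36) p.229, p.235, p.239 («□̃»); Balaban1985BackgroundPropagators, p.408] -/
theorem exists_abs_sub_ctr_le_of_mem_cubeDomY {z : SiteY x.toKIdx} (hz : z ∈ cubeDomY x c) (μ : Fin (d + 1)) :
    ∃ m : ℤ, |(z.1 μ : ℝ) - ((c.1.2 μ : ℝ) + 1 / 2) * (bigSide ℓ x.toKIdx.Mh c.1.1 : ℝ) -
      (N0 ℓ x.toKIdx.Mh x.toKIdx.k x.toKIdx.P' μ : ℝ) * m| ≤ 15 / 4 * (bigSide ℓ x.toKIdx.Mh c.1.1 : ℝ) - 1 := by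
  have h8 : 8 ≤ x.toKIdx.Mh := x.toKIdx.hM8
  have hzblk : blkOf x.toKIdx.D.toDomains z ∈ cubeBlksY x c := (mem_cubeDomY_iff_blkOf x c z).1 hz
  obtain ⟨hwin, hcong⟩ := window_and_congr_of_mem_QbigT x.toKIdx.D hL (le_trans (by norm_num) h8) x.toKIdx.hR2
    (one_le_Mh_and_P x.toKIdx).1 (four_le_P x) hzblk
  obtain ⟨m, hm⟩ := hcong μ
  have hrep := abs_sub_le_of_blkOf_eq x.toKIdx.D.toDomains (a := blkOf x.toKIdx.D.toDomains z) rfl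
    (blkOf_rep x.toKIdx.D.toDomains _) μ
  have hhalf := pow_le_half_bigSide (ℓ := ℓ) (le_trans (by norm_num) h8 : 2 ≤ x.toKIdx.Mh) hwin.2
  refine ⟨m, ?_⟩
  rw [abs_le] at hm hrep ⊢
  obtain ⟨hm1, hm2⟩ := hm
  obtain ⟨hr1, hr2⟩ := hrep
  constructor <;> linarith

/-- ★ **THE TORUS DIAMETER OF `□̃(c)`**: two sites of `cubeDomY x c` are at torus sup-distance `≤ 15S∕2 − 2`, `S = M_h L^{j(c)+1}`.
[cite: Balaban1984PropagatorsII, (2.2) p.224 (torus distance), p.235 («□̃»); Balaban1985BackgroundPropagators, p.408] -/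
theorem torusSupNorm_sub_le_of_mem_cubeDomY {z w : SiteY x.toKIdx} (hz : z ∈ cubeDomY x c) (hw : w ∈ cubeDomY x c) :
    torusSupNorm (N0 ℓ x.toKIdx.Mh x.toKIdx.k x.toKIdx.P') (z.1 - w.1) ≤ 15 / 2 * (bigSide ℓ x.toKIdx.Mh c.1.1 : ℝ) - 2 := by
  refine Finset.sup'_le _ _ fun μ _ => ?_
  obtain ⟨m, hm⟩ := exists_abs_sub_ctr_le_of_mem_cubeDomY x c hz μ
  obtain ⟨m', hm'⟩ := exists_abs_sub_ctr_le_of_mem_cubeDomY x c hw μ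
  have hN1 : 1 ≤ N0 ℓ x.toKIdx.Mh x.toKIdx.k x.toKIdx.P' μ := one_le_N0 x.toKIdx.hN μ
  set Nμ : ℕ := N0 ℓ x.toKIdx.Mh x.toKIdx.k x.toKIdx.P' μ with hNμ
  have key : circAbs Nμ ((z.1 - w.1) μ) = circAbs Nμ (z.1 μ - w.1 μ - (Nμ : ℤ) * (m - m')) := by
    rw [← circAbs_add_mul Nμ (z.1 μ - w.1 μ - (Nμ : ℤ) * (m - m')) (m - m'), Pi.sub_apply]
    congr 1; ring
  rw [key]
  have h1 : ((circAbs Nμ (z.1 μ - w.1 μ - (Nμ : ℤ) * (m - m')) : ℤ) : ℝ) ≤ |(((z.1 μ - w.1 μ - (Nμ : ℤ) * (m - m') : ℤ)) : ℝ)| := by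
    rw [← Int.cast_abs]; exact_mod_cast circAbs_le_abs hN1 _
  have e : (((z.1 μ - w.1 μ - (Nμ : ℤ) * (m - m') : ℤ)) : ℝ) =
      ((z.1 μ : ℝ) - ((c.1.2 μ : ℝ) + 1 / 2) * (bigSide ℓ x.toKIdx.Mh c.1.1 : ℝ) - (Nμ : ℝ) * m) -
        ((w.1 μ : ℝ) - ((c.1.2 μ : ℝ) + 1 / 2) * (bigSide ℓ x.toKIdx.Mh c.1.1 : ℝ) - (Nμ : ℝ) * m') := by
    push_cast; ring
  rw [e] at h1
  linarith [abs_sub (((z.1 μ : ℝ) - ((c.1.2 μ : ℝ) + 1 / 2) * (bigSide ℓ x.toKIdx.Mh c.1.1 : ℝ) - (Nμ : ℝ) * m))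
    ((w.1 μ : ℝ) - ((c.1.2 μ : ℝ) + 1 / 2) * (bigSide ℓ x.toKIdx.Mh c.1.1 : ℝ) - (Nμ : ℝ) * m')]

/-- the cube's WITNESS (a level-`j(c)` site of its central big block `β`) is within `S∕2` of the centre in every coordinate.
[cite: Balaban1984PropagatorsII, p.229 («with a center y ∈ Λ_j»), bookkeeping] -/
theorem abs_wit_sub_ctr_le (μ : Fin (d + 1)) :
    |((wit x.toKIdx.D.toDomains c).1 μ : ℝ) - ((c.1.2 μ : ℝ) + 1 / 2) * (bigSide ℓ x.toKIdx.Mh c.1.1 : ℝ)| ≤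
      (bigSide ℓ x.toKIdx.Mh c.1.1 : ℝ) / 2 := by
  have h := dist_toR_ctr_le x.toKIdx.D.toDomains (one_le_Mh_and_P x.toKIdx).1 (blk_wit x.toKIdx.D.toDomains c)
  have hμ := dist_le_pi_dist (toR (wit x.toKIdx.D.toDomains c).1) (ctr x.toKIdx.D.toDomains c) μ
  rw [Real.dist_eq] at hμ
  exact hμ.trans h

/-- ★ **THE WITNESS IS WITHIN `17S∕4` OF EVERY SITE OF `□̃(c)`** in the torus sup-distance. [cite: Balaban1984PropagatorsII, (2.2) p.224, p.229, p.235; Balaban1985BackgroundPropagators, p.408] -/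
theorem torusSupNorm_wit_sub_le_of_mem_cubeDomY {z : SiteY x.toKIdx} (hz : z ∈ cubeDomY x c) :
    torusSupNorm (N0 ℓ x.toKIdx.Mh x.toKIdx.k x.toKIdx.P') ((wit x.toKIdx.D.toDomains c).1 - z.1) ≤
      17 / 4 * (bigSide ℓ x.toKIdx.Mh c.1.1 : ℝ) - 1 := by
  refine Finset.sup'_le _ _ fun μ _ => ?_
  obtain ⟨m, hm⟩ := exists_abs_sub_ctr_le_of_mem_cubeDomY x c hz μ
  have hwit := abs_wit_sub_ctr_le x c μ
  have hN1 : 1 ≤ N0 ℓ x.toKIdx.Mh x.toKIdx.k x.toKIdx.P' μ := one_le_N0 x.toKIdx.hN μ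
  set Nμ : ℕ := N0 ℓ x.toKIdx.Mh x.toKIdx.k x.toKIdx.P' μ with hNμ
  have key : circAbs Nμ (((wit x.toKIdx.D.toDomains c).1 - z.1) μ) = circAbs Nμ ((wit x.toKIdx.D.toDomains c).1 μ - z.1 μ + (Nμ : ℤ) * m) := by
    rw [Pi.sub_apply, circAbs_add_mul]
  rw [key]
  have h1 : ((circAbs Nμ ((wit x.toKIdx.D.toDomains c).1 μ - z.1 μ + (Nμ : ℤ) * m) : ℤ) : ℝ) ≤
      |((((wit x.toKIdx.D.toDomains c).1 μ - z.1 μ + (Nμ : ℤ) * m : ℤ)) : ℝ)| := by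
    rw [← Int.cast_abs]; exact_mod_cast circAbs_le_abs hN1 _
  have e : ((((wit x.toKIdx.D.toDomains c).1 μ - z.1 μ + (Nμ : ℤ) * m : ℤ)) : ℝ) =
      (((wit x.toKIdx.D.toDomains c).1 μ : ℝ) - ((c.1.2 μ : ℝ) + 1 / 2) * (bigSide ℓ x.toKIdx.Mh c.1.1 : ℝ)) -
        ((z.1 μ : ℝ) - ((c.1.2 μ : ℝ) + 1 / 2) * (bigSide ℓ x.toKIdx.Mh c.1.1 : ℝ) - (Nμ : ℝ) * m) := by
    push_cast; ring
  rw [e] at h1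
  linarith [abs_sub ((((wit x.toKIdx.D.toDomains c).1 μ : ℝ) - ((c.1.2 μ : ℝ) + 1 / 2) * (bigSide ℓ x.toKIdx.Mh c.1.1 : ℝ)))
    ((z.1 μ : ℝ) - ((c.1.2 μ : ℝ) + 1 / 2) * (bigSide ℓ x.toKIdx.Mh c.1.1 : ℝ) - (Nμ : ℝ) * m)]

/-! ## §2 Levels on `□̃(c)` and on its collar from the separation (2.2) -/

/-- the THREE-level window of a site of `□̃(c)`: `j(c) − 1 ≤ lev z ≤ j(c) + 1` (r03). [cite: Balaban1984PropagatorsII, (2.2) p.224, p.235 («□̃»); Balaban1985BackgroundPropagators, p.408] -/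
theorem lev_window_of_mem_cubeDomY {z : SiteY x.toKIdx} (hz : z ∈ cubeDomY x c) :
    c.1.1 ≤ x.toKIdx.D.lev z.1 + 1 ∧ x.toKIdx.D.lev z.1 ≤ c.1.1 + 1 := by
  have h8 : 8 ≤ x.toKIdx.Mh := x.toKIdx.hM8
  have hzblk : blkOf x.toKIdx.D.toDomains z ∈ cubeBlksY x c := (mem_cubeDomY_iff_blkOf x c z).1 hz
  have hwin := (window_and_congr_of_mem_QbigT x.toKIdx.D hL (le_trans (by norm_num) h8) x.toKIdx.hR2
    (one_le_Mh_and_P x.toKIdx).1 (four_le_P x) hzblk).1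
  exact hwin

/-- ★ **A LEVEL-`(j(c)−1)` SITE IN `□̃(c)` FORCES `lev ≤ j(c)` ON ALL OF `□̃(c)`**: a site of level `≥ j(c)+1` would be `> R·S ≥ 8S` away from it ((2.2) at level `j(c)`),
against the diameter `15S∕2`. [cite: Balaban1984PropagatorsII, (2.2) p.224, (2.89) p.239; Balaban1985BackgroundPropagators, p.408] -/
theorem lev_le_of_mem_cubeDomY_of_low {z₀ : SiteY x.toKIdx} (hz₀ : z₀ ∈ cubeDomY x c) (hlow : x.toKIdx.D.lev z₀.1 + 1 = c.1.1)
    {z : SiteY x.toKIdx} (hz : z ∈ cubeDomY x c) : x.toKIdx.D.lev z.1 ≤ c.1.1 := by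
  by_contra hlt
  push Not at hlt
  have hsep := x.toKIdx.D.sepT c.1.1 z₀.1 z₀.2 z.1 z.2 (by omega) (by omega)
  have hdist := torusSupNorm_sub_le_of_mem_cubeDomY x c hz₀ hz
  have hR : (8 : ℝ) * (bigSide ℓ x.toKIdx.Mh c.1.1 : ℝ) ≤ ((x.toKIdx.R * bigSide ℓ x.toKIdx.Mh c.1.1 : ℕ) : ℝ) := by
    have h8 : (8 : ℝ) ≤ x.toKIdx.R := by exact_mod_cast eight_le_R x
    push_cast
    exact mul_le_mul_of_nonneg_right h8 (bigSide_pos x _).le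
  have hS := bigSide_pos x c.1.1
  linarith

/-- ADJACENT OR EQUAL scale-`n` blocks are torus-close: fine sites under `Y` and under `Y′ ∈ {Y, Y ± e_μ}` are at torus sup-distance `< 2Lⁿ` (r03).
[cite: Balaban1984PropagatorsII, (2.2) p.224 (torus distance), (2.45) p.231, bookkeeping] -/
theorem torusSupNorm_lt_of_adj {n : ℕ} (hn : n ≤ x.m + x.K) {Y Y' : Site (PV d ℓ x.m x.K hd hL) n}
    (h : Y' = Y ∨ ∃ μ, Y' = Y.shift μ ∨ Y = Y'.shift μ) {y y' : Site (PV d ℓ x.m x.K hd hL) 0} (hy : iterBlockOf n y = Y) (hy' : iterBlockOf n y' = Y') :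
    torusSupNorm (N0 ℓ x.toKIdx.Mh x.toKIdx.k x.toKIdx.P') ((toBox x.toKIdx.hN y).1 - (toBox x.toKIdx.hN y').1) < 2 * (((ℓ + 1 : ℕ) : ℝ)) ^ n := by
  rcases h with h | ⟨μ, h | h⟩
  · have h1 := torusSupNorm_lt_of_block_eq x.toKIdx.hN hn (x := y) (x' := y') (by rw [hy, hy', h])
    have h0 : (0 : ℝ) ≤ (((ℓ + 1 : ℕ) : ℝ)) ^ n := by positivity
    linarith
  · exact torusSupNorm_lt_of_block_shift x.toKIdx.hN hn (x := y) (x' := y') (by rw [hy', hy, h])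
  · have h1 := torusSupNorm_lt_of_block_shift x.toKIdx.hN hn (x := y') (x' := y) (by rw [hy, hy', h])
    rwa [← torusSupNorm_neg (one_le_N0 x.toKIdx.hN), neg_sub] at h1

/-- TWO `T^{(n)}`-STEPS around a block met by `□̃(c)` cost at most half a big block: for `n ≤ j(c) + 1`, a fine site `y` under `Y₂`, two steps from `Y₀ ∋ y₀`, is at torus
sup-distance `≤ S∕2` from `y₀` (`4Lⁿ ≤ S∕2`, `M_h ≥ 8`). [cite: Balaban1984PropagatorsII, (2.2) p.224, (2.36) p.229, bookkeeping] -/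
theorem torusSupNorm_le_of_two_steps {n : ℕ} (hn : n ≤ x.m + x.K) (hnc : n ≤ c.1.1 + 1) {Y₀ Y₁ Y₂ : Site (PV d ℓ x.m x.K hd hL) n}
    (h₁ : Y₁ = Y₀ ∨ ∃ μ, Y₁ = Y₀.shift μ ∨ Y₀ = Y₁.shift μ) (h₂ : Y₂ = Y₁ ∨ ∃ μ, Y₂ = Y₁.shift μ ∨ Y₁ = Y₂.shift μ)
    {y₀ y : Site (PV d ℓ x.m x.K hd hL) 0} (hy₀ : iterBlockOf n y₀ = Y₀) (hy : iterBlockOf n y = Y₂) :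
    torusSupNorm (N0 ℓ x.toKIdx.Mh x.toKIdx.k x.toKIdx.P') ((toBox x.toKIdx.hN y₀).1 - (toBox x.toKIdx.hN y).1) ≤
      (bigSide ℓ x.toKIdx.Mh c.1.1 : ℝ) / 2 := by
  obtain ⟨y₁, hy₁⟩ := exists_iterBlockOf_eq (hd := hd) (hL := hL) hn Y₁
  have d₁ := torusSupNorm_lt_of_adj x hn h₁ hy₀ hy₁
  have d₂ := torusSupNorm_lt_of_adj x hn h₂ hy₁ hy
  have tri := torusSupNorm_sub_le (one_le_N0 x.toKIdx.hN) (toBox x.toKIdx.hN y₀).1 (toBox x.toKIdx.hN y₁).1 (toBox x.toKIdx.hN y).1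
  have h4 := four_pow_le_half_bigSide x (j := c.1.1) hnc
  linarith

/-- ★ **NO SITE OF LEVEL `≥ j(c)+2` WITHIN `S∕2` OF `□̃(c)`**: such a site would be `> R·L·S` from the cube's level-`j(c)` witness ((2.2) at level `j(c)+1`), which is within
`17S∕4 + S∕2` of it. [cite: Balaban1984PropagatorsII, (2.2) p.224, (2.89) p.239; Balaban1985BackgroundPropagators, p.408] -/
theorem lev_le_succ_of_near_cubeDomY {y₀ y : Site (PV d ℓ x.m x.K hd hL) 0} (hy₀ : chartY x.toKIdx y₀ ∈ cubeDomY x c)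
    (hnear : torusSupNorm (N0 ℓ x.toKIdx.Mh x.toKIdx.k x.toKIdx.P') ((toBox x.toKIdx.hN y₀).1 - (toBox x.toKIdx.hN y).1) ≤
      (bigSide ℓ x.toKIdx.Mh c.1.1 : ℝ) / 2) :
    x.toKIdx.D.lev (toBox x.toKIdx.hN y : Fin (d + 1) → ℤ) ≤ c.1.1 + 1 := by
  by_contra hlt
  push Not at hlt
  have hwl : x.toKIdx.D.lev (wit x.toKIdx.D.toDomains c).1 = c.1.1 := lev_wit x.toKIdx.D.toDomains c
  have hsep := x.toKIdx.D.sepT (c.1.1 + 1) (wit x.toKIdx.D.toDomains c).1 (wit x.toKIdx.D.toDomains c).2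
    (toBox x.toKIdx.hN y).1 (toBox x.toKIdx.hN y).2 (by omega) (by omega)
  rw [chartY_eq_toBox] at hy₀
  have h1 := torusSupNorm_wit_sub_le_of_mem_cubeDomY x c hy₀
  have tri := torusSupNorm_sub_le (one_le_N0 x.toKIdx.hN) (wit x.toKIdx.D.toDomains c).1 (toBox x.toKIdx.hN y₀).1 (toBox x.toKIdx.hN y).1
  have hS := bigSide_pos x c.1.1
  -- `R·S_{j(c)+1} = R·L·S ≥ 5S`
  have hR : (5 : ℝ) * (bigSide ℓ x.toKIdx.Mh c.1.1 : ℝ) ≤ ((x.toKIdx.R * bigSide ℓ x.toKIdx.Mh (c.1.1 + 1) : ℕ) : ℝ) := by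
    have h8 : (8 : ℝ) ≤ x.toKIdx.R := by exact_mod_cast eight_le_R x
    have hL1 : (1 : ℝ) ≤ (((ℓ + 1 : ℕ) : ℝ)) := by exact_mod_cast Nat.succ_le_succ (Nat.zero_le ℓ)
    have e : ((x.toKIdx.R * bigSide ℓ x.toKIdx.Mh (c.1.1 + 1) : ℕ) : ℝ) = (x.toKIdx.R : ℝ) * (((ℓ + 1 : ℕ) : ℝ)) * (bigSide ℓ x.toKIdx.Mh c.1.1 : ℝ) := by
      unfold bigSide; push_cast; ring
    rw [e]
    have hRL : (8 : ℝ) ≤ (x.toKIdx.R : ℝ) * (((ℓ + 1 : ℕ) : ℝ)) := by nlinarith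
    have h3 := mul_le_mul_of_nonneg_right hRL hS.le
    linarith
  linarith

/-- ★ **WITH A LEVEL-`(j(c)−1)` SITE IN `□̃(c)`, NO SITE OF LEVEL `≥ j(c)+1` WITHIN `S∕2` OF `□̃(c)`** ((2.2) at level `j(c)`: `R·S ≥ 8S > 15S∕2 + S∕2 − 2`).
[cite: Balaban1984PropagatorsII, (2.2) p.224, (2.89) p.239; Balaban1985BackgroundPropagators, p.408] -/
theorem lev_le_of_near_cubeDomY_of_low {z₀ : SiteY x.toKIdx} (hz₀ : z₀ ∈ cubeDomY x c) (hlow : x.toKIdx.D.lev z₀.1 + 1 = c.1.1)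
    {y₀ y : Site (PV d ℓ x.m x.K hd hL) 0} (hy₀ : chartY x.toKIdx y₀ ∈ cubeDomY x c)
    (hnear : torusSupNorm (N0 ℓ x.toKIdx.Mh x.toKIdx.k x.toKIdx.P') ((toBox x.toKIdx.hN y₀).1 - (toBox x.toKIdx.hN y).1) ≤
      (bigSide ℓ x.toKIdx.Mh c.1.1 : ℝ) / 2) :
    x.toKIdx.D.lev (toBox x.toKIdx.hN y : Fin (d + 1) → ℤ) ≤ c.1.1 := by
  by_contra hlt
  push Not at hlt
  have hsep := x.toKIdx.D.sepT c.1.1 z₀.1 z₀.2 (toBox x.toKIdx.hN y).1 (toBox x.toKIdx.hN y).2 (by omega) (by omega)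
  rw [chartY_eq_toBox] at hy₀
  have h1 := torusSupNorm_sub_le_of_mem_cubeDomY x c hz₀ hy₀
  have tri := torusSupNorm_sub_le (one_le_N0 x.toKIdx.hN) z₀.1 (toBox x.toKIdx.hN y₀).1 (toBox x.toKIdx.hN y).1
  have hS := bigSide_pos x c.1.1
  have hR : (8 : ℝ) * (bigSide ℓ x.toKIdx.Mh c.1.1 : ℝ) ≤ ((x.toKIdx.R * bigSide ℓ x.toKIdx.Mh c.1.1 : ℕ) : ℝ) := by
    have h8 : (8 : ℝ) ≤ x.toKIdx.R := by exact_mod_cast eight_le_R x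
    push_cast
    exact mul_le_mul_of_nonneg_right h8 hS.le
  linarith

/-! ## §3 The two-level window of `□̃(c)` and of its two-block collar -/

/-- ★★★ **THE TWO-LEVEL WINDOW OF THE ENLARGED CUBE AND ITS COLLAR, FOR EVERY COVER CUBE AT EVERY MEMBER** — row 17's displayed `h2` and `hNbr2` DISCHARGED:
there is `j ∈ {j(c) − 1, j(c)}` with `j + 1 ≤ k` such that (`h2`) every fine site of `□̃(c) = cubeDomY x c` has level `j` or `j + 1`, and (`hNbr2`) every fine site
under a scale-`(j+1)` block two `T^{(j+1)}`-steps around a scale-`(j+1)` block meeting `□̃(c)` has level `≤ j + 1` — from `2L² ≤ R` (`KIdx.hR2`) alone: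
if `□̃(c)` holds a site of level `j(c) − 1` take `j = j(c) − 1` (`lev_le_of_mem_cubeDomY_of_low`, `lev_le_of_near_cubeDomY_of_low`), otherwise `j = j(c)`
(`lev_window_of_mem_cubeDomY`, `lev_le_succ_of_near_cubeDomY`) — or `j = k − 1` when `j(c) = k`.
[cite: Balaban1984PropagatorsII, (2.2) p.224, (2.89) p.239 («B^j(Λ) = □̃ ∩ B^{j+1}(Λ_{j+1})»); Balaban1985BackgroundPropagators, p.408 («□̃»), Thm 3.11 proof p.416] -/
theorem exists_twoLevel_window_cubeDomY :
    ∃ j : ℕ, j + 1 ≤ x.toKIdx.k ∧ (j = c.1.1 ∨ j + 1 = c.1.1) ∧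
      (∀ z ∈ cubeDomY x c, x.toKIdx.D.lev z.1 = j ∨ x.toKIdx.D.lev z.1 = j + 1) ∧
      (∀ Y₀ Y₁ Y₂ : Site (PV d ℓ x.m x.K hd hL) (j + 1),
        (∃ y : Site (PV d ℓ x.m x.K hd hL) 0, iterBlockOf (j + 1) y = Y₀ ∧ chartY x.toKIdx y ∈ cubeDomY x c) →
        (Y₁ = Y₀ ∨ ∃ μ, Y₁ = Y₀.shift μ ∨ Y₀ = Y₁.shift μ) → (Y₂ = Y₁ ∨ ∃ μ, Y₂ = Y₁.shift μ ∨ Y₁ = Y₂.shift μ) →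
        ∀ y : Site (PV d ℓ x.m x.K hd hL) 0, iterBlockOf (j + 1) y = Y₂ →
          x.toKIdx.D.lev (toBox x.toKIdx.hN y : Fin (d + 1) → ℤ) ≤ j + 1) := by
  have hck : 1 ≤ c.1.1 ∧ c.1.1 ≤ x.toKIdx.k := level_bounds x.toKIdx.D.toDomains c
  have hkm : x.toKIdx.k ≤ x.m + x.K := x.toKIdx.hk
  by_cases hA : ∃ z₀ ∈ cubeDomY x c, x.toKIdx.D.lev z₀.1 + 1 = c.1.1
  · -- the window `{j(c) − 1, j(c)}`
    obtain ⟨z₀, hz₀, hlow⟩ := hA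
    refine ⟨c.1.1 - 1, by omega, Or.inr (by omega), fun z hz => ?_, fun Y₀ Y₁ Y₂ hY₀ h₁ h₂ y hy => ?_⟩
    · have hw := lev_window_of_mem_cubeDomY x c hz
      have hle := lev_le_of_mem_cubeDomY_of_low x c hz₀ hlow hz
      omega
    · obtain ⟨y₀, hy₀, hD₀⟩ := hY₀
      have hn : c.1.1 - 1 + 1 ≤ x.m + x.K := by omega
      have hnear := torusSupNorm_le_of_two_steps x c hn (by omega) h₁ h₂ hy₀ hy
      have hle := lev_le_of_near_cubeDomY_of_low x c hz₀ hlow hD₀ hnear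
      omega
  · push Not at hA
    by_cases hk : c.1.1 + 1 ≤ x.toKIdx.k
    · -- the window `{j(c), j(c) + 1}`
      refine ⟨c.1.1, hk, Or.inl rfl, fun z hz => ?_, fun Y₀ Y₁ Y₂ hY₀ h₁ h₂ y hy => ?_⟩
      · have hw := lev_window_of_mem_cubeDomY x c hz
        have hne := hA z hz
        omega
      · obtain ⟨y₀, hy₀, hD₀⟩ := hY₀
        have hnear := torusSupNorm_le_of_two_steps x c (by omega) le_rfl h₁ h₂ hy₀ hy
        exact lev_le_succ_of_near_cubeDomY x c hD₀ hnear
    · -- `j(c) = k`: the window `{k − 1, k}` (every level is `≤ k`)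
      have hck' : c.1.1 = x.toKIdx.k := by omega
      refine ⟨c.1.1 - 1, by omega, Or.inr (by omega), fun z hz => ?_, fun Y₀ Y₁ Y₂ _ _ _ y _ => ?_⟩
      · have hw := lev_window_of_mem_cubeDomY x c hz
        have hne := hA z hz
        have hle := x.toKIdx.D.lev_le z.1
        omega
      · have hle := x.toKIdx.D.lev_le (toBox x.toKIdx.hN y : Fin (d + 1) → ℤ)
        omega

end Literature.MathematicalPhysics.QuantumFieldTheory.Balaban1983to89.B9LocalCubeGeometryTwoLevelWindowY

end
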